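import Summits.AtomisticToContinuum.BoseEinsteinCondensation.Theses.BECPhaseQuadratureSumRule
import Summits.AtomisticToContinuum.BoseEinsteinCondensation.Theorems.BECConjugateDominationPositiveMinimiserFinal
import HarnessLib

/-!
# Route `BECPhaseQuadratureSumRule`, support item `MinimiserRegularity` (stmt-AtomisticToContinuum-12619):
# the periodic `N`-body energy has a `C³` finite-energy minimiser

Closing file. For a pair potential `v` of the smooth class (repulsive finite range, finite, `C²` as
`x ↦ v(|x|)` on `ℝ³`, with the edge bound), every `N ≥ 1` and every `L > 0`, there is a periodic trial state
`Ψ : PeriodicTrialState N L` with `periodicEnergy v Ψ = periodicGroundStateEnergy v N L`, finite energy and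
`Ψ.ψ ∈ C³`.

This is the first three conjuncts of the already proved, stronger support item `PositiveMinimiser` of route
`BECConjugateDomination` (`Summit.AtomisticToContinuum.BoseEinsteinCondensation.Theorems.PositiveMinimiser_proof`,
file `BECConjugateDominationPositiveMinimiserFinal.lean`: torus Feynman–Kac ground state, Duhamel bootstrap to `C³`,
variational identification of the energy), after writing `N = n + 1`.

Sources: Reed–Simon IV §XIII.12 (Thms XIII.44/XIII.47); LSSY2005 p. 13 (bosonic = absolute ground state).
-/

namespace Summit.AtomisticToContinuum.BoseEinsteinCondensation.Theorems

open Literature.MathematicalPhysics.QuantumManyBody.BoseGas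

/-- **`MinimiserRegularity` (route `BECPhaseQuadratureSumRule`, item stmt-AtomisticToContinuum-12619), proved.**
For every smooth-class potential `v`, every `N ≥ 1` and `L > 0` the periodic `N`-body energy has a minimiser in the
`C¹` periodic Bose-symmetric class which is `C³` with finite energy: specialise the proved
`BECConjugateDomination.PositiveMinimiser` (`PositiveMinimiser_proof`) at `n = N - 1` and drop positivity.
[folklore] (Reed–Simon IV Thms XIII.44, XIII.47.) -/
theorem minimiserRegularity_proof :
    Theses.BECPhaseQuadratureSumRule.MinimiserRegularity := by
  intro v hv hfin hC2 hedge N hN L hL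
  obtain ⟨n, rfl⟩ : ∃ n, N = n + 1 := Nat.exists_eq_succ_of_ne_zero hN.ne'
  obtain ⟨Ψ, hE, hfinE, hC3, -, -⟩ := PositiveMinimiser_proof v hv hfin hC2 hedge n L hL
  exact ⟨Ψ, hE, hfinE, hC3⟩

end Summit.AtomisticToContinuum.BoseEinsteinCondensation.Theorems
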